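import Literature.AnabelianGeometry.SemiGraphs.ProSigmaFreeFactorLifting
import Literature.AnabelianGeometry.SemiGraphs.ProSigmaCuspMalnormalEngine
import HarnessLib

/-!
# Free-factor malnormality in pro-`Σ` completions, II: the engine at an open subgroup

Ribes–Zalesskii, *Profinite Groups* (2nd ed.), Thm. 9.1.12 [cite: RibesZalesskii2010, Thm. 9.1.12]
(free factors of free pro-`𝒞` products are malnormal), on the way to its Kurosh-free proof for free
pro-`Σ` GROUPS (`ProSigmaFreeFactorMalnormal.lean`).  Setting: `Γ` free with basis `b : β → Γ`,
`S ⊆ β`, `ρ` the retraction onto `Γ_S = ⟨b(S)⟩` killing the other basis elements, `ι : Γ → P` a pro-`Σ`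
completion (`P` profinite), `A = closure ι(Γ_S)`.

* `freeFactor_false_of_commute_of_character` — THE ENGINE: for an open subgroup `H ≤ P` with
  `ι⁻¹H = ρ⁻¹(Γ_S ∩ ι⁻¹H)` and a continuous homomorphism `χ : A ∩ H → M` to a finite abelian
  `Σ`-group, no `k ∈ H ∖ A` commutes with a `y ∈ A ∩ H` having `χ y ≠ 1`.

Proof: take a level `N ⊴ P` with `k ∉ (A ∩ H)N`; the subgroup `D = Γ_S ∩ ι⁻¹H` of the free group `Γ`
is free (Nielsen–Schreier, Mathlib), so its generators `g` may be lifted to `(δ_{χ(ιg)}, ḡ)` in the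
wreath product `M ≀ (P/N)`; the lifting lemma `exists_lift_of_retract` (part I) extends this over
`ι⁻¹H`, and `exists_continuous_extend` to `H`; by density `A ∩ H` is mapped into the subgroup of
elements supported on the image `H̄` of `A ∩ H`, with coordinate product `χ`
(`exists_wreathSupportHom`); the wreath obstruction `wreath_prod_left_eq_one_of_commute` (part I) then
gives `χ y = 1`.  Theorems only; classical profinite group theory; nothing here takes a side on
[IUTchIII] Cor. 3.12.
-/

namespace Literature.AnabelianGeometry.SemiGraphs.SemiGraphOfAnabelioids.IsProSigmaCompletion

open Literature.AnabelianGeometry.Anabelioids Topology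
open scoped Pointwise

variable {Sigma : Set ℕ} {Γ : Type*} [Group Γ] {P : Type*} [Group P] [TopologicalSpace P]
  [IsTopologicalGroup P] [CompactSpace P] [TotallyDisconnectedSpace P] {ι : Γ →* P}

/-! ### The engine at an open subgroup carrying an abelian character -/

/-- **The engine.**  Let `Γ` be free with basis `b`, `ρ` the retraction onto `Γ_S = ⟨b(S)⟩`,
`ι : Γ → P` a pro-`Σ` completion (`P` profinite), `A = closure ι(Γ_S)`, and `H ≤ P` an OPEN subgroup
with `ι γ ∈ H ↔ ι (ρ γ) ∈ H` (i.e. `ι⁻¹H = ρ⁻¹(Γ_S ∩ ι⁻¹H)`).  Let `χ : A ∩ H → M` be a continuous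
homomorphism to a finite abelian `Σ`-group.  If `k ∈ H ∖ A` commutes with `y ∈ A ∩ H`, then `χ y = 1`
(stated as: `χ y ≠ 1` is absurd).  Proof: level `N` with `k ∉ (A ∩ H)N`; lift the free subgroup
`D = Γ_S ∩ ι⁻¹H` to `M ≀ (P/N)` generator by generator, `g ↦ (δ_{χ(ιg)}, ḡ)`, extend over `ι⁻¹H` by the
lifting lemma and to `H` by continuity; `A ∩ H` lands in the subgroup supported on the image `H̄` of
`A ∩ H`, with coordinate product `χ`; the wreath obstruction gives `χ y = 1`.
[cite: RibesZalesskii2010, Thm. 9.1.12] -/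
theorem freeFactor_false_of_commute_of_character [T2Space P] {β : Type*} (b : FreeGroupBasis β Γ)
    (S : Set β) [DecidablePred (· ∈ S)] (ρ : Γ →* Γ) (hρ : ∀ j, ρ (b j) = if j ∈ S then b j else 1)
    (hι : IsProSigmaCompletion Sigma ι) (A : Subgroup P)
    (hA : A = ((Subgroup.closure (b '' S)).map ι).topologicalClosure)
    (H : Subgroup P) (hH : IsOpen (H : Set P)) (hHρ : ∀ γ, ι γ ∈ H ↔ ι (ρ γ) ∈ H)
    {M : Type*} [Group M] [Finite M] [TopologicalSpace M] [DiscreteTopology M]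
    (hMc : ∀ u v : M, u * v = v * u) (hM : IsSigmaInteger Sigma (Nat.card M))
    (χ : ↥(A ⊓ H) →* M) (hχ : Continuous χ) {y k : P} (hy : y ∈ A ⊓ H) (hχy : χ ⟨y, hy⟩ ≠ 1)
    (hk : k ∈ H) (hkA : k ∉ A) (hc : Commute k y) : False := by
  classical
  letI : CommGroup M := { ‹Group M› with mul_comm := hMc }
  let K : Subgroup P := A ⊓ H
  let ΓS : Subgroup Γ := Subgroup.closure (b '' S)
  obtain ⟨hρS, hρid, -⟩ := retract_mem_closure b S ρ hρ
  have hAle : ΓS.map ι ≤ A := by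
    rw [hA]
    exact Subgroup.le_topologicalClosure _
  have hAc : IsClosed (A : Set P) := by
    rw [hA]
    exact Subgroup.isClosed_topologicalClosure _
  -- Step 1: a level `N` with `k ∉ K · N`
  have hKclosed : IsClosed (K : Set P) := hAc.inter (H.isClosed_of_isOpen hH)
  have hkK : k ∉ K := fun h => hkA h.1
  obtain ⟨N, hN⟩ := exists_openNormalSubgroup_not_mem_mul hKclosed hkK
  haveI : (N : Subgroup P).Normal := N.isNormal'
  have hNo : IsOpen ((N : Subgroup P) : Set P) := N.isOpen'
  haveI : Finite (P ⧸ (N : Subgroup P)) := Subgroup.quotient_finite_of_isOpen _ hNo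
  letI : Fintype (P ⧸ (N : Subgroup P)) := Fintype.ofFinite _
  haveI : DiscreteTopology (P ⧸ (N : Subgroup P)) := QuotientGroup.discreteTopology hNo
  let π : P →* P ⧸ (N : Subgroup P) := QuotientGroup.mk' (N : Subgroup P)
  have hπc : Continuous π := QuotientGroup.continuous_mk
  have hQ : IsSigmaInteger Sigma (Nat.card (P ⧸ (N : Subgroup P))) := by
    rw [← Subgroup.index_eq_card]
    exact isSigmaInteger_index hι _ hNo
  -- `H̄ := π(K)`; `π k ∉ H̄ ∋ π y`
  let Hbar : Subgroup (P ⧸ (N : Subgroup P)) := K.map π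
  have hπk : π k ∉ Hbar := by
    rintro ⟨z, hz, hzk⟩
    have hzk' : z⁻¹ * k ∈ (N : Subgroup P) := by
      rw [← QuotientGroup.eq]
      exact hzk
    exact hN N le_rfl z hz (z⁻¹ * k) hzk' (mul_inv_cancel_left z k)
  have hπy : π y ∈ Hbar := ⟨y, hy, rfl⟩
  -- Step 2: the wreath product `W = M ≀ (P/N)`
  let W := M ≀ᵣ (P ⧸ (N : Subgroup P))
  letI : TopologicalSpace W := ⊥
  haveI : DiscreteTopology W := ⟨rfl⟩
  have hW : IsSigmaInteger Sigma (Nat.card W) := isSigmaInteger_card_regularWreath hM hQ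
  obtain ⟨WH, μ, hWH, hμ⟩ := exists_wreathSupportHom (M := M) Hbar
  -- Step 3: the discrete data `Γ₁ = ι⁻¹H`, `D = Γ_S ∩ Γ₁`
  let Γ₁ : Subgroup Γ := H.comap ι
  let D : Subgroup Γ := ΓS ⊓ Γ₁
  have hD : D ≤ ΓS := inf_le_left
  have hΓ₁ : ∀ γ, γ ∈ Γ₁ ↔ ρ γ ∈ D := by
    intro γ
    change ι γ ∈ H ↔ ρ γ ∈ ΓS ∧ ι (ρ γ) ∈ H
    rw [hHρ γ]
    exact ⟨fun h => ⟨hρS γ, h⟩, fun h => h.2⟩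
  have hDK : ∀ d, d ∈ D → ι d ∈ K := fun d hd => ⟨hAle ⟨d, hd.1, rfl⟩, hd.2⟩
  let ιK : D →* K := (ι.comp D.subtype).codRestrict K fun d => hDK d d.2
  -- `α` on the free generators of `D`: `g ↦ (δ_{χ(ι g)}, π ι g)`
  haveI : IsFreeGroup Γ := b.isFreeGroup
  let δ : M → (P ⧸ (N : Subgroup P)) → M := fun c q => if q = 1 then c else 1
  let cgen : IsFreeGroup.Generators D → M := fun a => χ (ιK (IsFreeGroup.of a))
  have hgenWH : ∀ a, (⟨δ (cgen a), π (ι (IsFreeGroup.of a : D))⟩ : W) ∈ WH := by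
    intro a
    rw [hWH]
    exact ⟨⟨ι (IsFreeGroup.of a : D), hDK _ (IsFreeGroup.of a).2, rfl⟩,
      (wreath_prod_indicator Hbar (cgen a)).1⟩
  let α' : D →* WH := IsFreeGroup.lift fun a => ⟨⟨δ (cgen a), π (ι (IsFreeGroup.of a : D))⟩, hgenWH a⟩
  let α : D →* W := WH.subtype.comp α'
  have hαof : ∀ a, α (IsFreeGroup.of a) = ⟨δ (cgen a), π (ι (IsFreeGroup.of a : D))⟩ := fun a => by
    change ((IsFreeGroup.lift _ (IsFreeGroup.of a) : WH) : W) = _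
    rw [IsFreeGroup.lift_of]
  have hαWH : ∀ d : D, α d ∈ WH := fun d => (α' d).2
  -- `α` lies over `π ∘ ι`
  have hαright : ∀ d : D, (α d).right = π (ι d) := by
    have : RegularWreathProduct.rightHom.comp α = (π.comp ι).comp D.subtype := by
      refine IsFreeGroup.ext_hom fun a => ?_
      simp only [MonoidHom.comp_apply, hαof]
      rfl
    intro d
    exact congrArg (fun F : D →* _ => F d) this
  -- `μ ∘ α = χ ∘ ι` on `D`
  have hμα : μ.comp α' = χ.comp ιK := by
    refine IsFreeGroup.ext_hom fun a => ?_
    simp only [MonoidHom.comp_apply]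
    rw [hμ]
    have e : ((α' (IsFreeGroup.of a) : WH) : W) = ⟨δ (cgen a), π (ι (IsFreeGroup.of a : D))⟩ :=
      hαof a
    rw [e]
    exact (wreath_prod_indicator Hbar (cgen a)).2
  -- Step 4: the lift `ψ₁ : Γ₁ → W` over `π`, and its continuous extension `ψ : H → W`
  let π₁ : Γ₁ →* P ⧸ (N : Subgroup P) := (π.comp ι).comp Γ₁.subtype
  let X : Γ → β → W := fun γ j => RegularWreathProduct.inl (π (ι (γ * b j * γ⁻¹)))
  obtain ⟨ψ₁, hψ₁D, hψ₁π⟩ := exists_lift_of_retract b S ρ hρ D Γ₁ hD hΓ₁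
    RegularWreathProduct.rightHom π₁ α (fun d hd hd₁ => hαright ⟨d, hd⟩) X
    (fun γ j _ h₁ => rfl)
  obtain ⟨ψ, hψc, hψι⟩ := exists_continuous_extend hι H hH hW ψ₁
  have hψright : ∀ h : H, (ψ h).right = π h := by
    have := continuous_ext_on hι H hH (F := fun h : H => (ψ h).right) (F' := fun h : H => π h)
      (continuous_of_discreteTopology.comp hψc) (hπc.comp continuous_subtype_val) (fun γ hγ => by
        change (ψ ⟨ι γ, hγ⟩).right = π (ι γ)
        rw [hψι γ hγ]
        exact hψ₁π ⟨γ, hγ⟩)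
    exact fun h => congrFun this h
  -- Step 5: on `K`, `ψ` lands in the supported subgroup and has coordinate product `χ`
  have hdense : Dense {x : K | (x : P) ∈ ι '' (D : Set Γ)} := by
    intro x
    rw [IsInducing.subtypeVal.closure_eq_preimage_closure_image, Set.mem_preimage]
    have hx : (x : P) ∈ closure (ι '' (D : Set Γ)) := by
      have h1 : (x : P) ∈ closure (ι '' (ΓS : Set Γ)) := by
        have h0 : (x : P) ∈ (A : Set P) := x.2.1
        rwa [hA, Subgroup.topologicalClosure_coe, Subgroup.coe_map] at h0
      refine closure_mono ?_ (IsOpen.inter_closure hH ⟨x.2.2, h1⟩)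
      rintro _ ⟨hzH, ⟨d, hd, rfl⟩⟩
      exact ⟨d, ⟨hd, hzH⟩, rfl⟩
    refine closure_mono ?_ hx
    rintro _ ⟨d, hd, rfl⟩
    exact ⟨⟨ι d, hDK d hd⟩, ⟨d, hd, rfl⟩, rfl⟩
  have hincl : Continuous fun x : K => (⟨(x : P), x.2.2⟩ : H) :=
    continuous_subtype_val.subtype_mk _
  have hψval : ∀ (x : K) (d : Γ) (hd : d ∈ D), ι d = (x : P) → ψ ⟨x, x.2.2⟩ = α ⟨d, hd⟩ := by
    intro x d hd hdx
    have e : (⟨(x : P), x.2.2⟩ : H) = ⟨ι d, hd.2⟩ := Subtype.ext hdx.symm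
    rw [e, hψι d hd.2, hψ₁D d hd hd.2]
  have hψK : ∀ x : K, ψ ⟨x, x.2.2⟩ ∈ WH := by
    have hcl : IsClosed {x : K | ψ ⟨x, x.2.2⟩ ∈ WH} :=
      (isClosed_discrete (WH : Set W)).preimage (hψc.comp hincl)
    have hsub : {x : K | (x : P) ∈ ι '' (D : Set Γ)} ⊆ {x : K | ψ ⟨x, x.2.2⟩ ∈ WH} := by
      rintro x ⟨d, hd, hdx⟩
      change ψ ⟨x, x.2.2⟩ ∈ WH
      rw [hψval x d hd hdx]
      exact hαWH _
    have huniv : closure {x : K | (x : P) ∈ ι '' (D : Set Γ)} ⊆ {x : K | ψ ⟨x, x.2.2⟩ ∈ WH} :=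
      hcl.closure_subset_iff.mpr hsub
    rw [hdense.closure_eq] at huniv
    exact fun x => huniv (Set.mem_univ x)
  have hμψ : ∀ x : K, μ ⟨ψ ⟨x, x.2.2⟩, hψK x⟩ = χ x := by
    have hcont : Continuous fun x : K => μ ⟨ψ ⟨x, x.2.2⟩, hψK x⟩ :=
      continuous_of_discreteTopology.comp ((hψc.comp hincl).subtype_mk _)
    have h := Continuous.ext_on hdense hcont hχ (by
      rintro x ⟨d, hd, hdx⟩
      change μ ⟨ψ ⟨x, x.2.2⟩, hψK x⟩ = χ x
      have e1 : (⟨ψ ⟨x, x.2.2⟩, hψK x⟩ : WH) = α' ⟨d, hd⟩ := Subtype.ext (hψval x d hd hdx)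
      have e2 : ιK ⟨d, hd⟩ = x := Subtype.ext hdx
      rw [e1, ← e2]
      exact congrArg (fun F : D →* M => F ⟨d, hd⟩) hμα)
    exact fun x => congrFun h x
  -- Step 6: the obstruction
  obtain ⟨hyr, hysupp⟩ := (hWH _).mp (hψK ⟨y, hy⟩)
  have hcH : Commute (⟨k, hk⟩ : H) ⟨y, hy.2⟩ := by
    rw [commute_iff_eq]
    exact Subtype.ext hc.eq
  have hkr : (ψ ⟨k, hk⟩).right ∉ Hbar := by
    rw [hψright]
    exact hπk
  have key := wreath_prod_left_eq_one_of_commute Hbar (ψ ⟨k, hk⟩) (ψ ⟨y, hy.2⟩) hkr hyr hysupp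
    (hcH.map ψ)
  apply hχy
  rw [← hμψ ⟨y, hy⟩, hμ]
  exact key

end Literature.AnabelianGeometry.SemiGraphs.SemiGraphOfAnabelioids.IsProSigmaCompletion
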